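import Summits.AnomalousDissipation.AnomalousDissipation.Theorems.SawtoothPulseCascadeK1LocalisedCascadeEnergySwitch

/-!
# K1loc, line `Spectral` / SeqCone — helper: THE PER-SLOT STEP AND THE END OF THE ENERGY LEDGER (S-C′ bookkeeping)

Helper file of the prover lane on the crux `K1LocalisedCascade` (stmt-AnomalousDissipation-19491), route
`SawtoothPulseCascade`, registered stub `stub_highModeConcentration` (memo v7 §2, steps (i)–(v) of the energy ledger S-C′).

* `ledger_step` — the real-arithmetic recombination of ONE half-slot of the energy ledger: from the input split
  `√(I₊² + I₋²) ≤ T₀ + a₁` (`…InputSplit`), the two family steps `O_σ ≤ I_σ + a₂` (`…FamilyStep`), and the slot switch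
  `T₁² ≤ (O₊ + c)² + (O₋ + c)² + R` (`…EnergySwitch.tsum_symbol_sq_switch_le`, `R` = disjoint cross + zone + overlap + layer
  terms) one gets `T₁² ≤ (T₀ + a₁ + √2·(a₂ + c))² + R` — the shape `T (s+1)² ≤ (T s + α_s)² + β_s` consumed by
  `…ZoneReadmit.sq_ledger_le`.  (The amplitude-junk chain of memo v6 is `…FamilySplit.recombine_families`; here the junk is inside `R`.)
* `lowModeEnergy_le_of_ledger_end` — the END of the ledger in energy: for a continuous real `v` (the solution at the final
  time), a smooth carrier `X̂` with `‖1 − X̂‖ ≤ 1`, and a real symbol `μ` with `|μ| ≤ M`, `μ² ≥ 1` on the low block `|k_i| < K`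
  and modulus `ω₂` of `μ²`:
  `Σ_{|k_i|<K} |𝓕v(k)|² ≤ Σ μ²|𝓕(X̂v)|² + M²∫|(1−X̂)v|² + 2((Σω₂|𝓕X̂|)∫|v|² + M²‖v‖·‖X̂(1−X̂)v‖)`
  (domination of the low block + `…ZoneReadmit.tsum_symbol_sq_le_readmit`), i.e. the hypothesis `hle` of
  `…FinalGlue.stub_form_of_lowModeEnergy_le` follows from the last tracked quantity `T_S²` plus the last zone/overlap terms,
  WITHOUT an amplitude junk term (compare `…FinalGlue.sqrt_lowModeEnergy_le_of_split`).

WHAT THIS IS NOT: no statement about the cascade or the stub itself. [cite: Grafakos2014, Prop. 3.2.7 (3) (Parseval)] [problem: turb]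
-/

-- `Summit.<Summit>.<Problem>`: single-conjunct summit, the duplicate namespace segment is deliberate.
set_option linter.dupNamespace false

noncomputable section

namespace Summit.AnomalousDissipation.AnomalousDissipation.Theorems.SawtoothPulseCascade.K1Slot

open MeasureTheory Set Filter Topology UnitAddTorus Complex
open scoped ComplexConjugate
open Literature.Analysis Literature.Analysis.FunctionSpaces Literature.Analysis.FluidPDE
open Literature.Analysis.FunctionSpaces.Torus
open Summit.AnomalousDissipation.AnomalousDissipation.Theorems.SawtoothPulseCascade.SpectralLeakage

variable {d : Type*} [Fintype d]

/-! ## §1 The per-slot recombination (real arithmetic) -/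

omit [Fintype d] in
/-- Minkowski in `ℝ²`: `√((u+s)² + (v+s)²) ≤ √(u²+v²) + √2·s` for `u, v, s ≥ 0`. [folklore] -/
theorem sqrt_sq_add_sq_add_le {u v s : ℝ} (hu : 0 ≤ u) (hv : 0 ≤ v) (hs : 0 ≤ s) :
    Real.sqrt ((u + s) ^ 2 + (v + s) ^ 2) ≤ Real.sqrt (u ^ 2 + v ^ 2) + Real.sqrt 2 * s := by
  have hs2 : Real.sqrt 2 ^ 2 = 2 := Real.sq_sqrt (by norm_num)
  set S := Real.sqrt (u ^ 2 + v ^ 2) with hS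
  have hS0 : 0 ≤ S := Real.sqrt_nonneg _
  have hS2 : S ^ 2 = u ^ 2 + v ^ 2 := Real.sq_sqrt (by positivity)
  have hsum : u + v ≤ Real.sqrt 2 * S := by
    have hsq : (u + v) ^ 2 ≤ (Real.sqrt 2 * S) ^ 2 := by
      rw [mul_pow, hs2, hS2]; nlinarith [sq_nonneg (u - v)]
    exact (pow_le_pow_iff_left₀ (by positivity) (by positivity) two_ne_zero).mp hsq
  have h : (u + s) ^ 2 + (v + s) ^ 2 ≤ (S + Real.sqrt 2 * s) ^ 2 := by
    have hexp : (S + Real.sqrt 2 * s) ^ 2 = S ^ 2 + 2 * (Real.sqrt 2 * S) * s + 2 * s ^ 2 := by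
      have : (Real.sqrt 2 * s) ^ 2 = 2 * s ^ 2 := by rw [mul_pow, hs2]
      nlinarith [this]
    rw [hexp, hS2]
    nlinarith [mul_le_mul_of_nonneg_right hsum hs]
  calc Real.sqrt ((u + s) ^ 2 + (v + s) ^ 2) ≤ Real.sqrt ((S + Real.sqrt 2 * s) ^ 2) := Real.sqrt_le_sqrt h
    _ = S + Real.sqrt 2 * s := Real.sqrt_sq (by positivity)

omit [Fintype d] in
/-- **One half-slot of the energy ledger (recombination).**  If `√(I₊² + I₋²) ≤ T₀ + a₁` (input split),
`O_σ ≤ I_σ + a₂` (family steps), and `T₁² ≤ (O₊ + c)² + (O₋ + c)² + R` (slot switch; `R` collects the disjoint cross term,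
the zone measure, the overlap and layer terms), with `I_σ, O_σ, a₂, c ≥ 0`, then
`T₁² ≤ (T₀ + a₁ + √2·(a₂ + c))² + R`. [folklore] -/
theorem ledger_step {T₀ T₁ Ip Im Op Om a₁ a₂ c R : ℝ} (hIp : 0 ≤ Ip) (hIm : 0 ≤ Im) (hOp : 0 ≤ Op)
    (hOm : 0 ≤ Om) (ha₂ : 0 ≤ a₂) (hc : 0 ≤ c)
    (hin : Real.sqrt (Ip ^ 2 + Im ^ 2) ≤ T₀ + a₁) (hp : Op ≤ Ip + a₂) (hm : Om ≤ Im + a₂)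
    (hsw : T₁ ^ 2 ≤ (Op + c) ^ 2 + (Om + c) ^ 2 + R) :
    T₁ ^ 2 ≤ (T₀ + a₁ + Real.sqrt 2 * (a₂ + c)) ^ 2 + R := by
  -- `(O₊+c)² + (O₋+c)² ≤ (I₊ + a₂ + c)² + (I₋ + a₂ + c)² ≤ (√(I₊²+I₋²) + √2(a₂+c))² ≤ (T₀ + a₁ + √2(a₂+c))²`
  have h1 : (Op + c) ^ 2 + (Om + c) ^ 2 ≤ (Ip + (a₂ + c)) ^ 2 + (Im + (a₂ + c)) ^ 2 := by
    have e1 : Op + c ≤ Ip + (a₂ + c) := by linarith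
    have e2 : Om + c ≤ Im + (a₂ + c) := by linarith
    exact add_le_add (pow_le_pow_left₀ (by positivity) e1 2) (pow_le_pow_left₀ (by positivity) e2 2)
  have h2 : (Ip + (a₂ + c)) ^ 2 + (Im + (a₂ + c)) ^ 2 ≤ (Real.sqrt (Ip ^ 2 + Im ^ 2) + Real.sqrt 2 * (a₂ + c)) ^ 2 := by
    have h := sqrt_sq_add_sq_add_le hIp hIm (add_nonneg ha₂ hc)
    have h0 : 0 ≤ (Ip + (a₂ + c)) ^ 2 + (Im + (a₂ + c)) ^ 2 := by positivity
    calc (Ip + (a₂ + c)) ^ 2 + (Im + (a₂ + c)) ^ 2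
        = (Real.sqrt ((Ip + (a₂ + c)) ^ 2 + (Im + (a₂ + c)) ^ 2)) ^ 2 := (Real.sq_sqrt h0).symm
      _ ≤ (Real.sqrt (Ip ^ 2 + Im ^ 2) + Real.sqrt 2 * (a₂ + c)) ^ 2 := pow_le_pow_left₀ (Real.sqrt_nonneg _) h 2
  have h3 : (Real.sqrt (Ip ^ 2 + Im ^ 2) + Real.sqrt 2 * (a₂ + c)) ^ 2 ≤ (T₀ + a₁ + Real.sqrt 2 * (a₂ + c)) ^ 2 := by
    refine pow_le_pow_left₀ (by positivity) ?_ 2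
    linarith
  linarith

/-! ## §2 The end of the ledger, in energy -/

/-- **The end of the energy ledger.**  For a continuous real `v : T^d → ℝ` with absolutely summable coefficients (e.g. smooth), a
continuous `X̂ : T^d → ℂ` with absolutely summable coefficients and `‖1 − X̂‖ ≤ 1`, a real symbol `|μ| ≤ M` with `1 ≤ μ²` on the
low block `|k_i| < K` and a modulus `ω₂` of `μ²`:
`Σ_{|k_i|<K} |𝓕v(k)|² ≤ Σ μ²|𝓕(X̂v)|² + M²∫‖(1−X̂)v‖² + 2((Σ ω₂‖𝓕X̂‖)∫‖v‖² + M²√(∫‖v‖²)√(∫‖X̂(1−X̂)v‖²))`.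
With `v = w(T)` this is the hypothesis `hle` of `…FinalGlue.stub_form_of_lowModeEnergy_le` from the last tracked quantity.
[cite: Grafakos2014, Prop. 3.2.7 (3)] -/
theorem lowModeEnergy_le_of_ledger_end {v : UnitAddTorus d → ℝ} (hv : Continuous v)
    (hvs : Summable fun k => ‖mFourierCoeff (fun x => (v x : ℂ)) k‖) {Xc : UnitAddTorus d → ℂ} (hXc : Continuous Xc)
    (hXcs : Summable fun k => ‖mFourierCoeff Xc k‖) (hXc1 : ∀ x, ‖1 - Xc x‖ ≤ 1) (i : d) (K : ℝ)
    {μ : (d → ℤ) → ℝ} {M : ℝ} (hμM : ∀ k, |μ k| ≤ M) (hlow : ∀ k : d → ℤ, |((k i : ℤ) : ℝ)| < K → 1 ≤ μ k ^ 2)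
    {ω₂ : (d → ℤ) → ℝ} (hω0 : ∀ n, 0 ≤ ω₂ n) (hω : ∀ k n, |μ k ^ 2 - μ (k - n) ^ 2| ≤ ω₂ n)
    (hωs : Summable fun n => ω₂ n * ‖mFourierCoeff Xc n‖) :
    ∑' k, (if |((k i : ℤ) : ℝ)| < K then (1 : ℝ) else 0) * ‖mFourierCoeff (fun x => (v x : ℂ)) k‖ ^ 2 ≤
      (∑' k, μ k ^ 2 * ‖mFourierCoeff (fun x => Xc x * (v x : ℂ)) k‖ ^ 2) +
        M ^ 2 * (∫ x, ‖(1 - Xc x) * (v x : ℂ)‖ ^ 2) +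
        2 * ((∑' n, ω₂ n * ‖mFourierCoeff Xc n‖) * (∫ x, ‖(v x : ℂ)‖ ^ 2) +
          M ^ 2 * Real.sqrt (∫ x, ‖(v x : ℂ)‖ ^ 2) * Real.sqrt (∫ x, ‖Xc x * (1 - Xc x) * (v x : ℂ)‖ ^ 2)) := by
  classical
  have hvc : Continuous fun x => (v x : ℂ) := Complex.continuous_ofReal.comp hv
  -- domination of the low block by `μ²`
  have hM0 : 0 ≤ M := (abs_nonneg _).trans (hμM 0)
  have hμ2 : ∀ k, μ k ^ 2 ≤ M ^ 2 := fun k => by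
    rw [← sq_abs]; exact pow_le_pow_left₀ (abs_nonneg _) (hμM k) 2
  have hP := hasSum_sq_mFourierCoeff_of_continuous hvc
  have hsμ : Summable fun k => μ k ^ 2 * ‖mFourierCoeff (fun x => (v x : ℂ)) k‖ ^ 2 :=
    (hP.summable.mul_left (M ^ 2)).of_nonneg_of_le (fun k => by positivity)
      fun k => mul_le_mul_of_nonneg_right (hμ2 k) (sq_nonneg _)
  have hw0 : ∀ k : d → ℤ, 0 ≤ (if |((k i : ℤ) : ℝ)| < K then (1 : ℝ) else 0) := fun k => by split_ifs <;> norm_num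
  have hle : ∀ k, (if |((k i : ℤ) : ℝ)| < K then (1 : ℝ) else 0) * ‖mFourierCoeff (fun x => (v x : ℂ)) k‖ ^ 2 ≤
      μ k ^ 2 * ‖mFourierCoeff (fun x => (v x : ℂ)) k‖ ^ 2 := fun k => by
    refine mul_le_mul_of_nonneg_right ?_ (sq_nonneg _)
    split_ifs with h
    · exact hlow k h
    · exact sq_nonneg _
  have hdom : ∑' k, (if |((k i : ℤ) : ℝ)| < K then (1 : ℝ) else 0) * ‖mFourierCoeff (fun x => (v x : ℂ)) k‖ ^ 2 ≤
      ∑' k, μ k ^ 2 * ‖mFourierCoeff (fun x => (v x : ℂ)) k‖ ^ 2 :=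
    (hsμ.of_nonneg_of_le (fun k => mul_nonneg (hw0 k) (sq_nonneg _)) hle).tsum_le_tsum hle hsμ
  -- re-admission with `W = v`, `Θ = X̂`
  have hre := tsum_symbol_sq_le_readmit (W := fun x => (v x : ℂ)) (Θ := Xc) hvc hvs hXc hXcs hXc1 hμM hω0 hω hωs
  exact hdom.trans hre

end Summit.AnomalousDissipation.AnomalousDissipation.Theorems.SawtoothPulseCascade.K1Slot
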